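import Mathlib
import Literature.AlgebraicGeometry.Resolution.MarkedIdealsLemmas
import Literature.AlgebraicGeometry.Resolution.BlowupsScaling
import Summits.ResolutionOfSingularities.ResolutionOfSingularities.Theorems.WildQuotientsWildQuotientResolutionBlowupExitConeTransferDepthTwo
import Summits.ResolutionOfSingularities.ResolutionOfSingularities.Theorems.WildQuotientsWildQuotientResolutionBlowupExitColonGlue

/-!
# The cone-brick transfer for a ONE-SHOT colon centre `𝓘_Z · (𝓘_Z² : 𝓘_A)` (RUNG V5, HP₀ variant β‴)
(crux stmt-ResolutionOfSingularities-15640 `WildQuotients.WildQuotientResolution`, line `Sketch`;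
chain w45c RUNG V5, res-L1-w45c-plan-1 RULING v8.4-B / `L/w45c/HP0-ONESHOT-DESIGN.md` §4
(«transfer twin, lead-1»); [OURS · L1 W4.5c] — generic glue, NOT a statement of any manuscript.
Lead prover res-L1-w45c-lead-1.)

Setting of `exists_isBlowup_regular_of_invariantsPresentation` (p503610): `ρ` an action of the
finite group `G` on `X → S` over an AFFINE base, `O` a `G`-stable open affine over `S`,
`ψ : R →+* Γ(O)` injective onto the invariants, `R` Noetherian. NEW centre: for TWO sets of
equations `𝔞, 𝔞' ⊆ Γ(O)` with radical contractions `√(ψ⁻¹⟨𝔞⟩) = J`, `√(ψ⁻¹⟨𝔞'⟩) = J'` (`J, J'`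
radical) and closed images `Z = q(V(𝔞))`, `A = q(V(𝔞'))` in `O/G`, the ONE-SHOT centre
`𝓘_Z · (𝓘_Z² : 𝓘_A)` (Literature `colon` of ideal sheaves) pulls back along `Spec R ≅ O/G`
(`exists_iso_spec_pieceQuot_zeroLocus`, p530183) to the ideal sheaf of `J · (J² : J')`; so
`Scheme.IsRegular (affineBlowup (J * (J^2).colon J'))` gives
`∃ B pB, IsBlowup pB (𝓘_Z · (𝓘_Z² : 𝓘_A)) ∧ IsRegular B`.

* `comap_colon_of_iso` — `(L : M)` pulls back along isomorphisms (adjunction `le_colon_iff`; no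
  Noetherian hypothesis); the ring/sheaf colon dictionary on `Spec R` is res-L1-w45c-stub-5's
  `…BlowupExitColonGlue` (p532809: `affineBlowup.idealSheaf_colon/_pow`, `comap_colon_of_isOpenImmersion`);
* `exists_isBlowup_regular_of_invariantsPresentation_mulColon` and its vertex-presentation form
  `exists_isBlowup_regular_of_vertexPresentation_mulColon` (both loci as vertex loci
  `π⁻¹V(F₀) ∖ ⋃_j V[⊤, y_j]`, p504270) — the `hP₀'` binder of HP0-ONESHOT-DESIGN §3.
-/

-- single-problem summit: the doubled namespace component `ResolutionOfSingularities` is forced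
set_option linter.dupNamespace false

noncomputable section

open CategoryTheory AlgebraicGeometry TopologicalSpace
open Literature.AlgebraicGeometry.Resolution Literature.AlgebraicGeometry.RelativeSpec

namespace Summit.ResolutionOfSingularities.ResolutionOfSingularities.Theorems.WildQuotientResolution.BlowupExit

/-! ## Colons pull back along isomorphisms -/

/-- **`(L : M)` pulls back along an isomorphism**: `e^*(L : M) = (e^*L : e^*M)` (formal, from the
adjunction `K ≤ (L : M) ↔ M·K ≤ L` and `comap_mul`). [folklore] -/
theorem comap_colon_of_iso {X Y : Scheme.{0}} (e : X ≅ Y) (L M : Y.IdealSheafData) :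
    (colon L M).comap e.hom = colon (L.comap e.hom) (M.comap e.hom) := by
  have hback : ∀ K : X.IdealSheafData, (K.comap e.inv).comap e.hom = K := fun K => by
    rw [← Scheme.IdealSheafData.comap_comp, e.hom_inv_id, Scheme.IdealSheafData.comap_id]
  have hback' : ∀ K : Y.IdealSheafData, (K.comap e.hom).comap e.inv = K := fun K => by
    rw [← Scheme.IdealSheafData.comap_comp, e.inv_hom_id, Scheme.IdealSheafData.comap_id]
  apply le_antisymm
  · rw [le_colon_iff, ← comap_mul]
    exact Scheme.IdealSheafData.comap_mono e.hom (mul_colon_le L M)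
  · rw [← hback (colon (L.comap e.hom) (M.comap e.hom))]
    refine Scheme.IdealSheafData.comap_mono e.hom ?_
    rw [le_colon_iff]
    have h : (M.comap e.hom * colon (L.comap e.hom) (M.comap e.hom)).comap e.inv ≤
        (L.comap e.hom).comap e.inv :=
      Scheme.IdealSheafData.comap_mono e.inv (mul_colon_le (L.comap e.hom) (M.comap e.hom))
    rw [comap_mul, hback', hback'] at h
    exact h

-- `Ideal.map_colon_of_bijective`, `affineBlowup.idealSheaf_colon`, `affineBlowup.idealSheaf_pow`,
-- `comap_colon_of_isOpenImmersion`: res-L1-w45c-stub-5's `…BlowupExitColonGlue` (p532809), imported.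

/-! ## The transfer -/

/-- **The cone-brick transfer for the one-shot colon centre** (see the module docstring).
[OURS · L1 W4.5c] [folklore; assembly of landed decls] -/
theorem exists_isBlowup_regular_of_invariantsPresentation_mulColon {X S : Scheme.{0}}
    {r : X ⟶ S} {G : Type} [Group G] [Finite G] (ρ : ActionOver r G) [S.IsSeparated]
    [IsSeparated r] [IsAffine S] (O : ρ.StableAffineOpens) {R : Type} [CommRing R]
    [IsNoetherianRing R]
    (ψ : R →+* Γ((O.1 : Scheme.{0}), (O.1.ι ≫ r) ⁻¹ᵁ ⊤)) (hψ : Function.Injective ψ)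
    (hrange : ψ.range = (ρ.restrict O.1 O.2.1).invariantsRing ⊤)
    (𝔞 𝔞' : Set Γ((O.1 : Scheme.{0}), (O.1.ι ≫ r) ⁻¹ᵁ ⊤)) (J J' : Ideal R) (hJr : J.IsRadical)
    (hJ'r : J'.IsRadical) (hJ : ((Ideal.span 𝔞).comap ψ).radical = J)
    (hJ' : ((Ideal.span 𝔞').comap ψ).radical = J')
    (hreg : Scheme.IsRegular (affineBlowup (J * (J ^ 2).colon (J' : Set R))))
    (Z A : Closeds (ρ.pieceQuot O))
    (hZ : (Z : Set (ρ.pieceQuot O)) = (ρ.pieceMk O).base '' ((O.1 : Scheme.{0}).zeroLocus 𝔞))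
    (hA : (A : Set (ρ.pieceQuot O)) = (ρ.pieceMk O).base '' ((O.1 : Scheme.{0}).zeroLocus 𝔞')) :
    ∃ (B : Scheme.{0}) (pB : B ⟶ ρ.pieceQuot O),
      IsBlowup pB (Scheme.IdealSheafData.vanishingIdeal Z *
        colon (Scheme.IdealSheafData.vanishingIdeal Z ^ 2) (Scheme.IdealSheafData.vanishingIdeal A)) ∧
      Scheme.IsRegular B := by
  classical
  obtain ⟨E, hE⟩ := exists_iso_spec_pieceQuot_zeroLocus ρ O ψ hψ hrange
  -- the two loci pulled back to `Spec R`
  have hZE : ((Z.preimage E.hom.continuous : Closeds (Spec (CommRingCat.of R))) :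
      Set (Spec (CommRingCat.of R))) = PrimeSpectrum.zeroLocus (J : Set R) := by
    rw [Closeds.coe_preimage, hZ, hE 𝔞, ← hJ, PrimeSpectrum.zeroLocus_radical]
  have hAE : ((A.preimage E.hom.continuous : Closeds (Spec (CommRingCat.of R))) :
      Set (Spec (CommRingCat.of R))) = PrimeSpectrum.zeroLocus (J' : Set R) := by
    rw [Closeds.coe_preimage, hA, hE 𝔞', ← hJ', PrimeSpectrum.zeroLocus_radical]
  have h𝓘Z : (Scheme.IdealSheafData.vanishingIdeal Z).comap E.hom = affineBlowup.idealSheaf J := by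
    rw [comap_vanishingIdeal_of_isOpenImmersion]
    exact vanishingIdeal_eq_idealSheaf_of_isRadical J hJr _ hZE
  have h𝓘A : (Scheme.IdealSheafData.vanishingIdeal A).comap E.hom = affineBlowup.idealSheaf J' := by
    rw [comap_vanishingIdeal_of_isOpenImmersion]
    exact vanishingIdeal_eq_idealSheaf_of_isRadical J' hJ'r _ hAE
  -- the one-shot centre pulls back to the ideal sheaf of `J · (J² : J')`
  have h𝓘 : (Scheme.IdealSheafData.vanishingIdeal Z *
      colon (Scheme.IdealSheafData.vanishingIdeal Z ^ 2)
        (Scheme.IdealSheafData.vanishingIdeal A)).comap E.hom =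
      affineBlowup.idealSheaf (J * (J ^ 2).colon (J' : Set R)) := by
    rw [comap_mul, comap_colon_of_iso, comap_pow, h𝓘Z, h𝓘A, affineBlowup.idealSheaf_mul,
      affineBlowup.idealSheaf_colon, affineBlowup.idealSheaf_pow]
  exact exists_isBlowup_regular_of_iso_spec E _ _ h𝓘 hreg

/-- **One-shot cone brick from a vertex presentation** (HP0-ONESHOT-DESIGN §3/§4): both loci are
vertex loci of the blowing up `π : V → Spec S` — the first centre `π⁻¹V(F₀) ∖ ⋃_{j ∈ κ} V[⊤, y_j]`
and the vertex locus `π⁻¹V(F₀) ∖ ⋃_{j ∈ κ'} V[⊤, y'_j]` carrying the colon; the ring brick `H`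
receives the chart ratios and must deliver `R₀` (Noetherian), `J, J'` radical with the two radical
identities, `ψ` injective onto the invariants, and `IsRegular (affineBlowup (J * (J^2).colon J'))`.
[OURS · L1 W4.5c] [folklore; assembly of landed decls] -/
theorem exists_isBlowup_regular_of_vertexPresentation_mulColon {S : Type} [CommRing S]
    {V : Scheme.{0}} {π : V ⟶ Spec (CommRingCat.of S)}
    {I : (Spec (CommRingCat.of S)).IdealSheafData}
    (hπ : IsBlowup π I) {Y : Scheme.{0}} (q : Spec (CommRingCat.of S) ⟶ Y) [IsAffine Y]
    {G : Type} [Group G] [Finite G] (ρB : ActionOver (π ≫ q) G) [IsSeparated (π ≫ q)]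
    {u : Γ(Spec (CommRingCat.of S), ⊤)} (hu : u ∈ I.ideal ⟨⊤, isAffineOpen_top _⟩)
    {κ : Type*} (y : κ → Γ(Spec (CommRingCat.of S), ⊤))
    (hy : ∀ j, y j ∈ I.ideal ⟨⊤, isAffineOpen_top _⟩)
    {κ' : Type*} (y' : κ' → Γ(Spec (CommRingCat.of S), ⊤))
    (hy' : ∀ j, y' j ∈ I.ideal ⟨⊤, isAffineOpen_top _⟩) (F₀ : Set S)
    (O : ρB.StableAffineOpens) (hO : O.1 ≤ blowupChart π I ⟨⊤, isAffineOpen_top _⟩ u)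
    (hle : ((O.1.ι ≫ π ≫ q) ⁻¹ᵁ ⊤ : (O.1 : Scheme.{0}).Opens) ≤
      O.1.ι ⁻¹ᵁ blowupChart π I ⟨⊤, isAffineOpen_top _⟩ u)
    (H : ∀ (T : κ → Γ(V, blowupChart π I ⟨⊤, isAffineOpen_top _⟩ u))
      (T' : κ' → Γ(V, blowupChart π I ⟨⊤, isAffineOpen_top _⟩ u)),
      (∀ j, π.appLE ⊤ (blowupChart π I ⟨⊤, isAffineOpen_top _⟩ u)
          (blowupChart_le_preimage π I ⟨⊤, isAffineOpen_top _⟩ u) (y j) =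
        π.appLE ⊤ (blowupChart π I ⟨⊤, isAffineOpen_top _⟩ u)
          (blowupChart_le_preimage π I ⟨⊤, isAffineOpen_top _⟩ u) u * T j) →
      (∀ j, π.appLE ⊤ (blowupChart π I ⟨⊤, isAffineOpen_top _⟩ u)
          (blowupChart_le_preimage π I ⟨⊤, isAffineOpen_top _⟩ u) (y' j) =
        π.appLE ⊤ (blowupChart π I ⟨⊤, isAffineOpen_top _⟩ u)
          (blowupChart_le_preimage π I ⟨⊤, isAffineOpen_top _⟩ u) u * T' j) →
      ∃ (R₀ : Type) (_ : CommRing R₀) (_ : IsNoetherianRing R₀) (J₀ J₀' : Ideal R₀)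
        (ψ : R₀ →+* Γ((O.1 : Scheme.{0}), (O.1.ι ≫ π ≫ q) ⁻¹ᵁ ⊤)),
        Function.Injective ψ ∧ ψ.range = (ρB.restrict O.1 O.2.1).invariantsRing ⊤ ∧
        J₀.IsRadical ∧ J₀'.IsRadical ∧
        ((Ideal.span ((O.1.ι.appLE (blowupChart π I ⟨⊤, isAffineOpen_top _⟩ u)
            ((O.1.ι ≫ π ≫ q) ⁻¹ᵁ ⊤) hle) ''
          ((π.appLE ⊤ (blowupChart π I ⟨⊤, isAffineOpen_top _⟩ u)
              (blowupChart_le_preimage π I ⟨⊤, isAffineOpen_top _⟩ u)) ''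
            ((Scheme.ΓSpecIso (CommRingCat.of S)).inv '' F₀) ∪ Set.range T))).comap ψ).radical = J₀ ∧
        ((Ideal.span ((O.1.ι.appLE (blowupChart π I ⟨⊤, isAffineOpen_top _⟩ u)
            ((O.1.ι ≫ π ≫ q) ⁻¹ᵁ ⊤) hle) ''
          ((π.appLE ⊤ (blowupChart π I ⟨⊤, isAffineOpen_top _⟩ u)
              (blowupChart_le_preimage π I ⟨⊤, isAffineOpen_top _⟩ u)) ''
            ((Scheme.ΓSpecIso (CommRingCat.of S)).inv '' F₀) ∪ Set.range T'))).comap ψ).radical =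
          J₀' ∧
        Scheme.IsRegular (affineBlowup (J₀ * (J₀ ^ 2).colon (J₀' : Set R₀))))
    (Z A : Closeds (ρB.pieceQuot O))
    (hZ : (Z : Set (ρB.pieceQuot O)) = (ρB.pieceMk O).base ''
      (O.1.ι.base ⁻¹' ({v | π.base v ∈ PrimeSpectrum.zeroLocus F₀} \
        ((⨆ j, blowupChart π I ⟨⊤, isAffineOpen_top _⟩ (y j) : V.Opens) : Set V))))
    (hA : (A : Set (ρB.pieceQuot O)) = (ρB.pieceMk O).base ''
      (O.1.ι.base ⁻¹' ({v | π.base v ∈ PrimeSpectrum.zeroLocus F₀} \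
        ((⨆ j, blowupChart π I ⟨⊤, isAffineOpen_top _⟩ (y' j) : V.Opens) : Set V)))) :
    ∃ (B : Scheme.{0}) (pB : B ⟶ ρB.pieceQuot O),
      IsBlowup pB (Scheme.IdealSheafData.vanishingIdeal Z *
        colon (Scheme.IdealSheafData.vanishingIdeal Z ^ 2) (Scheme.IdealSheafData.vanishingIdeal A)) ∧
      Scheme.IsRegular B := by
  classical
  haveI : Y.IsSeparated := inferInstance
  have hT : ∀ j, ∃ T : Γ(V, blowupChart π I ⟨⊤, isAffineOpen_top _⟩ u),
      π.appLE ⊤ (blowupChart π I ⟨⊤, isAffineOpen_top _⟩ u)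
          (blowupChart_le_preimage π I ⟨⊤, isAffineOpen_top _⟩ u) (y j) =
        π.appLE ⊤ (blowupChart π I ⟨⊤, isAffineOpen_top _⟩ u)
          (blowupChart_le_preimage π I ⟨⊤, isAffineOpen_top _⟩ u) u * T :=
    fun j => hπ.exists_chartRatio ⟨⊤, isAffineOpen_top _⟩ hu (hy j)
  choose T hT using hT
  have hT' : ∀ j, ∃ T : Γ(V, blowupChart π I ⟨⊤, isAffineOpen_top _⟩ u),
      π.appLE ⊤ (blowupChart π I ⟨⊤, isAffineOpen_top _⟩ u)
          (blowupChart_le_preimage π I ⟨⊤, isAffineOpen_top _⟩ u) (y' j) =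
        π.appLE ⊤ (blowupChart π I ⟨⊤, isAffineOpen_top _⟩ u)
          (blowupChart_le_preimage π I ⟨⊤, isAffineOpen_top _⟩ u) u * T :=
    fun j => hπ.exists_chartRatio ⟨⊤, isAffineOpen_top _⟩ hu (hy' j)
  choose T' hT' using hT'
  obtain ⟨R₀, _, _, J₀, J₀', ψ, hψ, hrange, hJ₀, hJ₀', hJ, hJ', hreg⟩ := H T T' hT hT'
  have hU' : ((O.1.ι ≫ π ≫ q) ⁻¹ᵁ ⊤ : (O.1 : Scheme.{0}).Opens) = ⊤ := Scheme.Hom.preimage_top _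
  have hZ₁ := hZ
  rw [preimage_ι_vertexLocus_eq_zeroLocus_spec hπ hu y hy T hT F₀ O.1 hO _ hU' hle] at hZ₁
  have hA₁ := hA
  rw [preimage_ι_vertexLocus_eq_zeroLocus_spec hπ hu y' hy' T' hT' F₀ O.1 hO _ hU' hle] at hA₁
  exact exists_isBlowup_regular_of_invariantsPresentation_mulColon ρB O ψ hψ hrange _ _ J₀ J₀' hJ₀
    hJ₀' hJ hJ' hreg Z A hZ₁ hA₁

end Summit.ResolutionOfSingularities.ResolutionOfSingularities.Theorems.WildQuotientResolution.BlowupExit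

end
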